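import Mathlib.Topology.ContinuousMap.Bounded.Normed
import Summits.QuantumFields.BalabanUV.T4Continuum.Support.NE9PolydiscChain

/-!
# NE9StateLinftyEquiv — ROUTE R4♯ «POLYDISC SCHWARZ–PICK», PART 3∕3: the bookkeeping isometries making K2♭'s ambient state
# space `ℓ^∞(B₁;ℂ) × (I →ᵇ ℓ^∞(ι;ℂ))` an `ℓ^∞(A;ℂ)`, and the drop-in END `ne9_and_fadingMemory_of_holoSelfMaps_state`
# (the planner kernel `t4/ideate/NE9/lens1-NE9PolydiscKernel.lean` sha16 a147eb83d7390d11, t4-ne9-idea-1 generation 5, §8 +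
# the END of §9, proofs VERBATIM — filed with PARTS 1–2 because leaf-04's docking (F-ne9leaf04g46-1, `…_SP`) reads «§1–§6 +
# §8 in the tree»; the planner's §7 ∕ §9 EXTENSION lemmas (`exists_extension_linfty ∕ _of_linftyEquiv ∕ _fut`: `ℓ^∞(ι;ℂ)` is
# 1-injective) are NOT filed — the owner's `NE9ChannelReadingOfRecord.extCLM` (p253328 §5, `extCLM_apply_coe`,
# `norm_extCLM_le`) IS that lemma in `def` form, and the `Fut`-valued variant is `bcfLinftyEquiv.symm ∘ extCLM p
# (bcfLinftyEquiv ∘ T)`; cell `pub-balaban`, T4-DAG §2 node U3 ∕ §6 NE9; unit `b2b-balaban-t4-ne9-formalise-leaf-03`,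
# generation 41; Summits-side bookkeeping, nothing of any import modified, nothing printed asserted, no named fact, 0 `def … :
# Prop`; data defs = the kernel's `ofBdd`, `sumElim`, `restrL`, `restrR`, `flat`, `unflat` and four `≃ₗᵢ`)

HONEST FRAMING (T4-DAG PAGE 1).  Rung (B)+1 of the FINITE-VOLUME T⁴ programme — NOT infinite volume, NOT a mass gap, NOT
the Clay problem.  NE9 is a cell NEW ESTIMATE, NOT PRINTED in [I] = CMP **109** ∕ [II] = CMP **116**, NOT PROVED (spine 0∕9);
the END below is PART 2's `ne9_and_fadingMemory_of_holoSelfMaps_polydisc` with `e := stateLinftyEquiv B₁ I ι` — hypotheses →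
`NE9 ∧ FadingMemory`, the instance `HoloSelfMaps` asserted of nothing.  HONEST DEPENDENCY (cell line, verbatim): continuum YM
on T⁴ ⇐ BetaPertH ∧ nine spine estimates (0/9 proved); BetaPertH ⇐ (D1) ∧ (D4) ∧ CAP+tail; G-an2-4 gates asym, D1 and
NE2/3/4.  Nothing of Bałaban's is constructed here.

WHAT (all kernel-checked, 0 sorry).
* §8 `ofBdd`, `sumElim`, `restrL`, `restrR`, **`prodLinftyEquiv : ℓ^∞(A;ℂ) × ℓ^∞(B;ℂ) ≃ₗᵢ[ℂ] ℓ^∞(A ⊕ B;ℂ)`** (the product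
  carries the max norm), `flat`, `unflat`, **`bcfLinftyEquiv : (I →ᵇ ℓ^∞(ι;ℂ)) ≃ₗᵢ[ℂ] ℓ^∞(I × ι;ℂ)`** (`I` discrete — K2♭'s
  `Fut W Pot = (Idx W →ᵇ Pot)` with `Pot = ℓ^∞(ι;ℂ)`, tree `NE9FutureProfileStep` p252939), `prodMapLIE`, and
  **`stateLinftyEquiv B₁ I ι : ℓ^∞(B₁;ℂ) × (I →ᵇ ℓ^∞(ι;ℂ)) ≃ₗᵢ[ℂ] ℓ^∞(B₁ ⊕ I × ι;ℂ)`** — with `B₁ := Bg × C.Dom` these are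
  EXACTLY the owner's D3 spaces (`NE9FutureProfileRecordPrelim`, p254124: `JRec : lp (fun _ : Bg × C.Dom => ℂ) ∞ →L[ℂ]
  Fut W (lp (fun _ : ι => ℂ) ∞)`).
* §9 **`ne9_and_fadingMemory_of_holoSelfMaps_state`** — PART 2's END on that state space with NO `e` argument; binders = the
  tree END's (p252549 `ne9_and_fadingMemory_of_holoSelfMaps`), verbatim: `NE9 E W κ (prodModuli (cR·(1∕(1−θ²))·ℓ) (fun _ ↦ θ))
  ∧ FadingMemory (cR·(1∕(1−θ²))·ℓ∕θ) θ (…)`.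
DISGUISE TEST: no inequality of the series; no Bałaban object; 0 sorry; no named fact; nothing printed asserted.

References: [Balaban1988RG2Cluster] T. Bałaban, CMP **116** (1988) 1–22 (TYPES ∕ loci only; nothing asserted).
-/

noncomputable section

namespace Summit.QuantumFields.BalabanUV.T4Continuum.NE9StateLinftyEquiv

open Metric Set
open scoped ENNReal
open Summit.QuantumFields.BalabanUV.T4Continuum.NE9EarleHamiltonChain (HoloSelfMaps)
open Summit.QuantumFields.BalabanUV.T4Continuum.NE9PolydiscChain (ne9_and_fadingMemory_of_holoSelfMaps_polydisc)
open Literature.MathematicalPhysics.QuantumFieldTheory.Balaban1983to89.T4OutputRate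
open Literature.MathematicalPhysics.QuantumFieldTheory.Balaban1983to89.T4HistoryLipschitzRecursion (prodModuli)

/-! ## §8 Bookkeeping isometries: K2♭'s ambient state space `ℓ^∞(B₁;ℂ) × (I →ᵇ ℓ^∞(ι;ℂ))` IS an `ℓ^∞(A;ℂ)` -/

section Bookkeeping

variable {A B : Type*} {I : Type*} [TopologicalSpace I] [DiscreteTopology I] {ι : Type*}

/-- A bounded family as an element of `ℓ^∞`. [folklore] -/
def ofBdd (g : A → ℂ) (M : ℝ) (h : ∀ a, ‖g a‖ ≤ M) : lp (fun _ : A => ℂ) ∞ :=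
  ⟨g, memℓp_infty ⟨M, by rintro _ ⟨a, rfl⟩; exact h a⟩⟩

/-- The underlying function of `ofBdd`. [folklore] -/
@[simp] theorem coe_ofBdd (g : A → ℂ) (M : ℝ) (h : ∀ a, ‖g a‖ ≤ M) :
    ((ofBdd g M h : lp (fun _ : A => ℂ) ∞) : A → ℂ) = g := rfl

/-- `(x, y) ↦ Sum.elim x y`. [folklore] -/
def sumElim (x : lp (fun _ : A => ℂ) ∞) (y : lp (fun _ : B => ℂ) ∞) : lp (fun _ : A ⊕ B => ℂ) ∞ :=
  ofBdd (Sum.elim (x : A → ℂ) (y : B → ℂ)) (max ‖x‖ ‖y‖) (fun c => by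
    cases c with
    | inl a => exact (lp.norm_apply_le_norm ENNReal.top_ne_zero x a).trans (le_max_left _ _)
    | inr b => exact (lp.norm_apply_le_norm ENNReal.top_ne_zero y b).trans (le_max_right _ _))

/-- Restriction to the left summand. [folklore] -/
def restrL (z : lp (fun _ : A ⊕ B => ℂ) ∞) : lp (fun _ : A => ℂ) ∞ :=
  ofBdd (fun a => z (Sum.inl a)) ‖z‖ (fun _ => lp.norm_apply_le_norm ENNReal.top_ne_zero z _)

/-- Restriction to the right summand. [folklore] -/
def restrR (z : lp (fun _ : A ⊕ B => ℂ) ∞) : lp (fun _ : B => ℂ) ∞ :=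
  ofBdd (fun b => z (Sum.inr b)) ‖z‖ (fun _ => lp.norm_apply_le_norm ENNReal.top_ne_zero z _)

/-- **`ℓ^∞(A;ℂ) × ℓ^∞(B;ℂ) ≅ ℓ^∞(A ⊕ B;ℂ)`** isometrically (the product carries the max norm). [folklore] -/
def prodLinftyEquiv : (lp (fun _ : A => ℂ) ∞ × lp (fun _ : B => ℂ) ∞) ≃ₗᵢ[ℂ] lp (fun _ : A ⊕ B => ℂ) ∞ where
  toFun p := sumElim p.1 p.2
  map_add' p q := lp.ext (funext fun c => by rcases c with a | b <;> rfl)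
  map_smul' c p := lp.ext (funext fun d => by rcases d with a | b <;> rfl)
  invFun z := (restrL z, restrR z)
  left_inv p := Prod.ext (lp.ext (funext fun a => rfl)) (lp.ext (funext fun b => rfl))
  right_inv z := lp.ext (funext fun c => by rcases c with a | b <;> rfl)
  norm_map' p := by
    show ‖sumElim p.1 p.2‖ = ‖p‖
    refine le_antisymm (lp.norm_le_of_forall_le (norm_nonneg p) fun c => ?_) ?_
    · rcases c with a | b
      · exact (lp.norm_apply_le_norm ENNReal.top_ne_zero p.1 a).trans (norm_fst_le p)
      · exact (lp.norm_apply_le_norm ENNReal.top_ne_zero p.2 b).trans (norm_snd_le p)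
    · rw [Prod.norm_def]
      refine max_le (lp.norm_le_of_forall_le (norm_nonneg _) fun a => ?_)
        (lp.norm_le_of_forall_le (norm_nonneg _) fun b => ?_)
      · exact lp.norm_apply_le_norm ENNReal.top_ne_zero (sumElim p.1 p.2) (Sum.inl a)
      · exact lp.norm_apply_le_norm ENNReal.top_ne_zero (sumElim p.1 p.2) (Sum.inr b)

/-- Flattening `(I →ᵇ ℓ^∞(ι;ℂ)) → ℓ^∞(I × ι;ℂ)`. [folklore] -/
def flat (x : BoundedContinuousFunction I (lp (fun _ : ι => ℂ) ∞)) : lp (fun _ : I × ι => ℂ) ∞ :=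
  ofBdd (fun q : I × ι => x q.1 q.2) ‖x‖
    (fun q => (lp.norm_apply_le_norm ENNReal.top_ne_zero (x q.1) q.2).trans (x.norm_coe_le_norm q.1))

/-- Un-flattening `ℓ^∞(I × ι;ℂ) → (I →ᵇ ℓ^∞(ι;ℂ))` (`I` discrete). [folklore] -/
def unflat (z : lp (fun _ : I × ι => ℂ) ∞) : BoundedContinuousFunction I (lp (fun _ : ι => ℂ) ∞) :=
  BoundedContinuousFunction.ofNormedAddCommGroupDiscrete
    (fun i => ofBdd (fun a => z (i, a)) ‖z‖ (fun a => lp.norm_apply_le_norm ENNReal.top_ne_zero z (i, a))) ‖z‖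
    (fun i => lp.norm_le_of_forall_le (norm_nonneg z) fun a => lp.norm_apply_le_norm ENNReal.top_ne_zero z (i, a))

/-- **`(I →ᵇ ℓ^∞(ι;ℂ)) ≅ ℓ^∞(I × ι;ℂ)`** isometrically, `I` discrete — e.g. K2♭'s `Fut W Pot = (Idx W →ᵇ Pot)` with
`Pot = ℓ^∞(ι;ℂ)` (tree `NE9FutureProfileStep`). [folklore] -/
def bcfLinftyEquiv : BoundedContinuousFunction I (lp (fun _ : ι => ℂ) ∞) ≃ₗᵢ[ℂ] lp (fun _ : I × ι => ℂ) ∞ where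
  toFun := flat
  map_add' x y := lp.ext (funext fun q => rfl)
  map_smul' c x := lp.ext (funext fun q => rfl)
  invFun := unflat
  left_inv x := BoundedContinuousFunction.ext fun i => lp.ext (funext fun a => rfl)
  right_inv z := lp.ext (funext fun q => rfl)
  norm_map' x := by
    show ‖flat x‖ = ‖x‖
    refine le_antisymm (lp.norm_le_of_forall_le (norm_nonneg x) fun q =>
      (lp.norm_apply_le_norm ENNReal.top_ne_zero (x q.1) q.2).trans (x.norm_coe_le_norm q.1)) ?_
    refine (BoundedContinuousFunction.norm_le (norm_nonneg _)).2 fun i =>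
      lp.norm_le_of_forall_le (norm_nonneg _) fun a => ?_
    exact lp.norm_apply_le_norm ENNReal.top_ne_zero (flat x) (i, a)

/-- Product of linear isometric isomorphisms (max norms). [folklore] -/
def prodMapLIE {E E' F F' : Type*} [NormedAddCommGroup E] [NormedSpace ℂ E] [NormedAddCommGroup E']
    [NormedSpace ℂ E'] [NormedAddCommGroup F] [NormedSpace ℂ F] [NormedAddCommGroup F'] [NormedSpace ℂ F']
    (e₁ : E ≃ₗᵢ[ℂ] E') (e₂ : F ≃ₗᵢ[ℂ] F') : (E × F) ≃ₗᵢ[ℂ] (E' × F') where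
  toLinearEquiv := e₁.toLinearEquiv.prodCongr e₂.toLinearEquiv
  norm_map' p := by
    show ‖(e₁.toLinearEquiv.prodCongr e₂.toLinearEquiv) p‖ = ‖p‖
    rw [LinearEquiv.prodCongr_apply, Prod.norm_def, Prod.norm_def]
    simp

/-- **THE DOCKING ISOMETRY for R4♯**: K2♭'s ambient state space `ℓ^∞(B₁;ℂ) × (I →ᵇ ℓ^∞(ι;ℂ))` (slice coordinates
`B₁ = Bg × C.Dom` of `NE9SliceSpaceOfRecord`, future potentials `I = Idx W`) is isometrically `ℓ^∞(B₁ ⊕ I × ι; ℂ)` — the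
hypothesis `e` of §6. [folklore] -/
def stateLinftyEquiv (B₁ : Type*) (I : Type*) [TopologicalSpace I] [DiscreteTopology I] (ι : Type*) :
    (lp (fun _ : B₁ => ℂ) ∞ × BoundedContinuousFunction I (lp (fun _ : ι => ℂ) ∞)) ≃ₗᵢ[ℂ]
      lp (fun _ : B₁ ⊕ I × ι => ℂ) ∞ :=
  (prodMapLIE (LinearIsometryEquiv.refl ℂ _) bcfLinftyEquiv).trans prodLinftyEquiv

end Bookkeeping

/-! ## §9 Drop-in form for K2♭'s ambient state space `ℓ^∞(B₁;ℂ) × (I →ᵇ ℓ^∞(ι;ℂ))` -/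

section DropIn

variable {B₁ : Type*} {I : Type*} [TopologicalSpace I] [DiscreteTopology I] {ι : Type*}
/-- **ROUTE R4♯ END, DROP-IN FORM**: §6 on K2♭'s ambient state space `ℓ^∞(B₁;ℂ) × (I →ᵇ ℓ^∞(ι;ℂ))` (no `e` argument —
`e := stateLinftyEquiv B₁ I ι`); binders = the tree END's, verbatim.  HONEST: hypotheses → `NE9 ∧ FadingMemory`; NE9 NOT
PRINTED, NOT PROVED; spine 0∕9. [folklore] -/
theorem ne9_and_fadingMemory_of_holoSelfMaps_state
    {C : Carriers} {Bg : Type} (E : Functional C Bg) (W : Set (ℕ → ℝ))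
    (S : ℕ → (ℕ → ℝ) → (lp (fun _ : B₁ => ℂ) ∞ × BoundedContinuousFunction I (lp (fun _ : ι => ℂ) ∞)) →
      (lp (fun _ : B₁ => ℂ) ∞ × BoundedContinuousFunction I (lp (fun _ : ι => ℂ) ∞)))
    (emb : ℕ → (ℕ → ℝ) → (lp (fun _ : B₁ => ℂ) ∞ × BoundedContinuousFunction I (lp (fun _ : ι => ℂ) ∞)))
    {κ r θ ℓ cR : ℝ} {lam : ℕ → ℝ}
    (hr : 0 < r) (hθ0 : 0 < θ) (hθ1 : θ < 1) (hℓ : 0 ≤ ℓ) (hcR : 0 ≤ cR)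
    (hS : HoloSelfMaps S W r θ)
    (hfac : ∀ j, ∀ g ∈ W, emb (j + 1) g = S j g (emb j g))
    (h0 : ∀ g ∈ W, ∀ g' ∈ W, emb 0 g = emb 0 g')
    (h0in : ∀ g ∈ W, emb 0 g ∈ closedBall (0 : lp (fun _ : B₁ => ℂ) ∞ × BoundedContinuousFunction I (lp (fun _ : ι => ℂ) ∞))
      (θ * r))
    (hlast : ∀ j, ∀ g ∈ W, ∀ g' ∈ W, ‖S j g (emb j g) - S j g' (emb j g)‖ ≤ lam j * |g j - g' j|)
    (hlam : ∀ j, lam j ≤ ℓ)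
    (hread : ∀ g ∈ W, ∀ g' ∈ W, ∀ (U : Bg) (X : C.Dom),
      |E g U X - E g' U X| ≤ Real.exp (-(κ * C.d X)) * (cR * ‖emb (C.scale X) g - emb (C.scale X) g'‖)) :
    NE9 E W κ (prodModuli (cR * (1 / (1 - θ ^ 2)) * ℓ) fun _ => θ) ∧
      FadingMemory (cR * (1 / (1 - θ ^ 2)) * ℓ / θ) θ (prodModuli (cR * (1 / (1 - θ ^ 2)) * ℓ) fun _ => θ) :=
  ne9_and_fadingMemory_of_holoSelfMaps_polydisc (stateLinftyEquiv B₁ I ι) E W S emb hr hθ0 hθ1 hℓ hcR hS hfac h0 h0in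
    hlast hlam hread

end DropIn

end Summit.QuantumFields.BalabanUV.T4Continuum.NE9StateLinftyEquiv

end
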